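import Mathlib
import Literature.Computability.AlgebraicComplexity.BirkhoffShadow
import Summits.ValiantsHypothesis.ValiantsHypothesis.Theses.DivisionGap

/-!
# Sketch — crux-ideate round 2, ideator 4 (crux `DivisionGap.ShadowBirkhoff`, stmt-ValiantsHypothesis-5069)

First-lemma signatures for the idea card `ternary-cut-counter-tension-fork`.

* `TernaryCutCounter` — the NEW explicit exponential parametric `s`–`t` min-cut family ("ternary two-polarity
  counter"), stated in its abstract point model: digits `v i = 3^i`; a cut of the network `N_K` is a pair
  `(α, β) : (Fin K → Bool) × (Fin K → Bool)` (`α_i = [z'_i ∈ S]`, `β_i = [z_i ∉ S]`); its two capacities are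
  `X = (v·α + v·β)/2` and `Y = (v·α)(v·β) + ½ Σ_{α_i ≠ β_i} v_i² − 3S·X`; the claim is that every DIAGONAL cut
  `(D, D)` is the strict unique minimiser of `Y − μ X` for some `μ`, i.e. all `2^K` diagonal cuts are vertices
  of the lower hull, i.e. the parametric min-cut of `N_K` (2K+2 nodes, K²+3K arcs, O(K)-bit capacities) has
  `≥ 2^K − 1` breakpoints.  Verified exhaustively for `K ≤ 9` (folder `exp/counter_hull.py`); `K = 3` is
  kernel-checked below by `decide` with explicit supporting slopes.
* `PencilWitnesses → ShadowBirkhoff` — the (routine) glue any Birkhoff-side realisation would feed.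
-/

set_option linter.dupNamespace false

namespace Summit.ValiantsHypothesis.ValiantsHypothesis.Cruxes.ShadowBirkhoff.Ideator4

open Finset

/-- digit weights `3^i` -/
def v (K : ℕ) (i : Fin K) : ℤ := 3 ^ (i : ℕ)

/-- `v · α` for a Boolean digit vector -/
def sdot (K : ℕ) (α : Fin K → Bool) : ℤ := ∑ i, (if α i then v K i else 0)

/-- `Σ_{i : α_i ≠ β_i} v_i²` -/
def qdis (K : ℕ) (α β : Fin K → Bool) : ℤ := ∑ i, (if α i ≠ β i then v K i * v K i else 0)

/-- twice the abscissa: `2X = v·α + v·β` -/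
def X2 (K : ℕ) (α β : Fin K → Bool) : ℤ := sdot K α + sdot K β

/-- four times the reduced ordinate: `4Ỹ = 4 (v·α)(v·β) + 2 Σ_{α_i≠β_i} v_i²`
(the term `−3S·X` of the actual capacity is affine in `X` and does not change lower-hull vertices). -/
def Y4 (K : ℕ) (α β : Fin K → Bool) : ℤ := 4 * sdot K α * sdot K β + 2 * qdis K α β

/-- The ternary two-polarity counter theorem (abstract form): for every `K` and every digit vector `D`,
some integer slope `μ` strictly supports the diagonal point `(D,D)` against ALL `4^K` cut points. -/
def TernaryCutCounter : Prop :=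
  ∀ K : ℕ, ∀ D : Fin K → Bool, ∃ μ : ℤ, ∀ α β : Fin K → Bool, (α, β) ≠ (D, D) →
    Y4 K D D - μ * X2 K D D < Y4 K α β - μ * X2 K α β

/-- explicit supporting slopes for `K = 3` (found by the folder script; `D` read as the binary number
`D 0 + 2 D 1 + 4 D 2`). -/
def mu3 (D : Fin 3 → Bool) : ℤ :=
  match D 0, D 1, D 2 with
  | false, false, false => -5
  | true,  false, false => 3
  | false, true,  false => 9
  | true,  true,  false => 15
  | false, false, true  => 29
  | true,  false, true  => 39
  | false, true,  true  => 45
  | true,  true,  true  => 51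

/-- Kernel-checked instance `K = 3` of `TernaryCutCounter`: all 8 diagonal cuts of `N_3` are strict
lower-hull vertices among the 64 cuts (so the parametric min-cut of this 8-node network has ≥ 7 breakpoints). -/
theorem ternaryCutCounter_three :
    ∀ D : Fin 3 → Bool, ∀ α β : Fin 3 → Bool, (α, β) ≠ (D, D) →
      Y4 3 D D - mu3 D * X2 3 D D < Y4 3 α β - mu3 D * X2 3 α β := by
  decide

/-- A family of pencil witnesses: for every `c`, eventually some linear `L : ℝ^{n×n} → ℝ²` and more than
`2^{(log₂ n + c)^c}` permutation matrices each of which is the STRICT unique minimiser over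
`permMatrixPoints n` of some linear functional factoring through `L` — the shape in which any
Birkhoff-side realisation of the counter (the card's C⁺) would deliver the crux. -/
def PencilWitnesses : Prop :=
  ∀ c : ℕ, ∃ n₀ : ℕ, ∀ n ≥ n₀, ∃ L : (Fin n × Fin n → ℝ) →ₗ[ℝ] (Fin 2 → ℝ),
    ∃ N : ℕ, 2 ^ ((Nat.log 2 n + c) ^ c) < N ∧
    ∃ x : Fin N → (Fin n × Fin n → ℝ), Function.Injective x ∧
      (∀ k, x k ∈ Literature.Computability.AlgebraicComplexity.permMatrixPoints n) ∧
      ∀ k, ∃ φ : (Fin 2 → ℝ) →ₗ[ℝ] ℝ,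
        ∀ y ∈ Literature.Computability.AlgebraicComplexity.permMatrixPoints n, y ≠ x k → φ (L (x k)) < φ (L y)

/-- glue (routine; the analogue was proved sorry-free for the round-1 lines as `stub_faceVertices`):
strict unique minimisers of functionals factoring through `L` are extreme points of the shadow, distinct
ones give distinct extreme points. -/
theorem shadowBirkhoff_of_pencilWitnesses (h : PencilWitnesses) :
    Summit.ValiantsHypothesis.ValiantsHypothesis.Theses.DivisionGap.ShadowBirkhoff := by
  sorry

end Summit.ValiantsHypothesis.ValiantsHypothesis.Cruxes.ShadowBirkhoff.Ideator4
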